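import Mathlib
import Summits.Ventures.PercRepro.TriangleCapAvoidCount

/-!
# PercRepro — THE STABILITY OF THE PAIR COUNT AND OF THE CLOSED FORM ON THE BIPARTITE CLASS: a triangle-free
graph with `r ≥ 2` edges that is not a star has `Σ_v d(v)² + 2 (r − 2) ≤ r (r + 1)`, and a spanning subgraph of
`K_{a,k−a}` whose `r` missing pairs are not a star is `2 (r − 2)` below the closed form (p3, gen 42; part 184)

The pair count `Σ_v C(d(v),2) ≤ C(r,2)` (part 101) is tight exactly on the stars and the triangle.  Its
stability on the triangle-free class (`sum_deg_sq_le_of_not_star`): if no vertex lies on every edge, at least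
`r − 2` pairs of edges are disjoint — with `v₀` of maximum degree `Δ ≥ 2` and `s = r − Δ ≥ 1` edges off `v₀`,
the `s (Δ − 1) ≥ r − 2` disjoint pairs of part 183 are counted from both ends in `Σ nonIncident ≥ 4 s (Δ − 1)`, and
`2 Σ d² = 2 r (r + 1) − Σ nonIncident`; when every degree is `≤ 1` the graph is a matching with `Σ d² = 2 r`.  At
`r = 2` the slack is exactly `2` (`sum_deg_sq_le_of_not_star_two`).  On a cell of the cherry table
(`closed_form_stability_bipSub`, `_two`): a spanning subgraph of `K(A, Aᶜ)`, `|A| = a`, with `r` missing cross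
pairs that do not form a star has `Σ_v d(v)² + r (k − 1 − r) + 2 (r − 2) ≤ m k` (`r ≥ 3`; `+ 2` at `r = 2`) —
the second-best value of the closed form on the bipartite class, sharp on a star of `r − 1` pairs plus a pair
at a leaf (`r ≥ 3`) and on a matching (`r = 2`).  Axioms: standard.
-/

namespace PercRepro

namespace TriangleCap

namespace C047

open Finset

variable {V : Type*} [Fintype V] [DecidableEq V]

/-- **THE STABILITY OF THE PAIR COUNT:** a triangle-free graph with `r ≥ 2` edges in which no vertex lies on every
edge has `Σ_v d(v)² + 2 (r − 2) ≤ r (r + 1)`. -/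
theorem sum_deg_sq_le_of_not_star (H : SimpleGraph V) [DecidableRel H.Adj] (hfree : H.CliqueFree 3)
    (hr : 2 ≤ H.edgeFinset.card) (hns : ∀ v, ∃ e ∈ H.edgeFinset, v ∉ e) :
    ∑ v, deg H v * deg H v + 2 * (H.edgeFinset.card - 2) ≤ H.edgeFinset.card * (H.edgeFinset.card + 1) := by
  have hsum := sum_adjPairsAll_nonIncident_eq H
  rw [sum_adjPairsAll_deg_add] at hsum
  -- a vertex of maximum degree
  have hne : (univ : Finset V).Nonempty := by
    obtain ⟨e, he⟩ := card_pos.mp (by omega : 0 < H.edgeFinset.card)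
    revert he
    refine Sym2.ind (fun x y _ => ⟨x, mem_univ x⟩) e
  obtain ⟨v₀, -, hmax⟩ := exists_max_image univ (fun v => deg H v) hne
  -- the edges off `v₀`
  have hoff : (H.edgeFinset.filter (fun e => v₀ ∉ e)).card + deg H v₀ = H.edgeFinset.card := by
    have := card_filter_add_card_filter_not (s := H.edgeFinset) (fun e => v₀ ∉ e)
    have h2 : H.edgeFinset.filter (fun e => ¬ v₀ ∉ e) = H.incidenceFinset v₀ := by
      ext e
      simp only [mem_filter, SimpleGraph.mem_incidenceFinset, SimpleGraph.mem_edgeFinset, not_not]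
      rfl
    rw [h2, ← deg_eq_card_incidenceFinset] at this
    exact this
  have hs : 1 ≤ (H.edgeFinset.filter (fun e => v₀ ∉ e)).card := by
    obtain ⟨e, he, hv⟩ := hns v₀
    exact card_pos.mpr ⟨e, mem_filter.mpr ⟨he, hv⟩⟩
  rcases Nat.lt_or_ge (deg H v₀) 2 with hΔ | hΔ
  · -- every degree `≤ 1`: `Σ d² = Σ d = 2 r`
    have hall : ∀ v, deg H v * deg H v = deg H v := by
      intro v
      have := hmax v (mem_univ v)
      have : deg H v ≤ 1 := by omega
      interval_cases h : deg H v <;> simp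
    have h3 := sum_deg_eq H
    rw [sum_congr rfl (fun v _ => hall v)]
    obtain ⟨m', hm'⟩ : ∃ m', H.edgeFinset.card = m' + 2 := ⟨H.edgeFinset.card - 2, by omega⟩
    rw [hm'] at h3 ⊢
    rw [Nat.add_sub_cancel]
    nlinarith [h3]
  · -- `Σ nonIncident ≥ 4 s (Δ − 1) ≥ 4 (r − 2)`
    have hsplit := sum_filter_add_sum_filter_not (adjPairsAll H) (fun p : V × V => p.1 ≠ v₀ ∧ p.2 ≠ v₀)
      (fun p => nonIncident H p.1 p.2)
    have hP1 : ((adjPairsAll H).filter (fun p : V × V => p.1 ≠ v₀ ∧ p.2 ≠ v₀)).card * (deg H v₀ - 1) ≤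
        ∑ p ∈ (adjPairsAll H).filter (fun p : V × V => p.1 ≠ v₀ ∧ p.2 ≠ v₀), nonIncident H p.1 p.2 := by
      rw [← smul_eq_mul, ← sum_const]
      apply sum_le_sum
      intro p hp
      rw [mem_filter, mem_adjPairsAll] at hp
      have := nonIncident_ge_of_off H hfree v₀ hp.1 hp.2.1 hp.2.2
      omega
    have hP2 := sum_nonIncident_at_eq H v₀
    have hP2' := sum_nonIncident_at_ge H hfree v₀
    have hcard := card_adjPairs_off_vertex H v₀
    -- the arithmetic: `s (Δ − 1) ≥ r − 2` for `s + Δ = r`, `s ≥ 1`, `Δ ≥ 2`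
    set s := (H.edgeFinset.filter (fun e => v₀ ∉ e)).card with hs'
    set Δ := deg H v₀ with hΔ'
    clear_value s Δ
    have key : H.edgeFinset.card - 2 ≤ s * (Δ - 1) := by
      obtain ⟨d, rfl⟩ : ∃ d, Δ = d + 2 := ⟨Δ - 2, by omega⟩
      obtain ⟨t, rfl⟩ : ∃ t, s = t + 1 := ⟨s - 1, by omega⟩
      have : H.edgeFinset.card = t + d + 3 := by omega
      rw [this]
      have e1 : t + d + 3 - 2 = t + d + 1 := by omega
      have e2 : d + 2 - 1 = d + 1 := by omega
      rw [e1, e2]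
      nlinarith [Nat.zero_le (t * d)]
    rw [← hsplit] at hsum
    have hP1' : 2 * s * (Δ - 1) ≤
        ∑ p ∈ (adjPairsAll H).filter (fun p : V × V => p.1 ≠ v₀ ∧ p.2 ≠ v₀), nonIncident H p.1 p.2 := by
      have : ((adjPairsAll H).filter (fun p : V × V => p.1 ≠ v₀ ∧ p.2 ≠ v₀)).card = 2 * s := by omega
      rw [this] at hP1
      exact hP1
    nlinarith [hsum, hP1', hP2, hP2', key]

omit [Fintype V] in
/-- A spanning subgraph of a complete bipartite graph is triangle-free. -/
theorem cliqueFree_of_bipSub (H : SimpleGraph V) [DecidableRel H.Adj] (A : Finset V) (hH : BipSub H A) :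
    H.CliqueFree 3 := by
  intro t ht
  obtain ⟨x, y, z, hxy, hxz, hyz, -⟩ := SimpleGraph.is3Clique_iff.mp ht
  have h1 := hH x y hxy
  have h2 := hH x z hxz
  have h3 := hH y z hyz
  tauto

/-- **THE STABILITY OF THE CLOSED FORM ON THE BIPARTITE CLASS:** a spanning subgraph of `K(A, Aᶜ)`, `|A| = a`,
with `r ≥ 2` missing cross pairs that do NOT form a star has `Σ_v d(v)² + r (k − 1 − r) + 2 (r − 2) ≤ m k` —
the closed form's bound with the slack `2 (r − 2)` (sharp: a star of `r − 1` pairs plus a pair at a leaf). -/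
theorem closed_form_stability_bipSub (D : SimpleGraph V) [DecidableRel D.Adj] (A : Finset V) (hD : BipSub D A)
    (a r : ℕ) (hA : A.card = a) (hm : D.edgeFinset.card + r = a * (Fintype.card V - a))
    (hr : r + 1 ≤ Fintype.card V) (hr2 : 2 ≤ r) (hns : ¬ ∃ v, MissingStar D A v) :
    ∑ v, deg D v * deg D v + r * (Fintype.card V - 1 - r) + 2 * (r - 2) ≤
      D.edgeFinset.card * Fintype.card V := by
  have key := sum_deg_sq_bipSub D A hD
  have hM := card_edges_missingGraph D A hD a r hA hm
  rw [hM, hA] at key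
  -- the missing graph is triangle-free with `r` edges and no vertex on all of them
  have hfree := cliqueFree_of_bipSub (missingGraph D A) A (bipSub_missingGraph D A)
  have hns' : ∀ v, ∃ e ∈ (missingGraph D A).edgeFinset, v ∉ e := by
    intro v
    by_contra hcon
    push Not at hcon
    apply hns
    refine ⟨v, fun x y hx hy hxy => ?_⟩
    have he : s(x, y) ∈ (missingGraph D A).edgeFinset := by
      rw [SimpleGraph.mem_edgeFinset, SimpleGraph.mem_edgeSet, missingGraph_adj]
      exact ⟨by tauto, hxy⟩
    have := hcon _ he
    rw [Sym2.mem_iff] at this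
    rcases this with h | h
    · exact Or.inl h.symm
    · exact Or.inr h.symm
  have hstab := sum_deg_sq_le_of_not_star (missingGraph D A) hfree (by omega) hns'
  rw [hM] at hstab
  obtain ⟨s, hs⟩ : ∃ s, Fintype.card V = r + 1 + s := ⟨_, (Nat.add_sub_cancel' hr).symm⟩
  have e : r + 1 + s - 1 - r = s := by omega
  rw [hs, e]
  rw [hs] at key hm
  obtain ⟨r', rfl⟩ : ∃ r', r = r' + 2 := ⟨r - 2, by omega⟩
  rw [Nat.add_sub_cancel] at hstab ⊢
  generalize hS : ∑ v, deg D v * deg D v = S at key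
  generalize hH : ∑ v, deg (missingGraph D A) v * deg (missingGraph D A) v = H at key hstab
  generalize hM' : D.edgeFinset.card = M at key hm
  generalize hP : a * (r' + 2 + 1 + s - a) = P at key hm
  nlinarith [key, hm, hstab]

/-- **THE CASE `r = 2`:** two edges that do not share a vertex form a matching, `Σ_v d(v)² = 4 = r (r + 1) − 2`. -/
theorem sum_deg_sq_le_of_not_star_two (H : SimpleGraph V) [DecidableRel H.Adj] (hr : H.edgeFinset.card = 2)
    (hns : ∀ v, ∃ e ∈ H.edgeFinset, v ∉ e) : ∑ v, deg H v * deg H v + 2 ≤ H.edgeFinset.card * (H.edgeFinset.card + 1) := by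
  have hall : ∀ v, deg H v ≤ 1 := by
    intro v
    by_contra hcon
    push Not at hcon
    -- the two edges are both at `v`: `v` lies on every edge
    have h1 : H.incidenceFinset v = H.edgeFinset := by
      apply eq_of_subset_of_card_le (H.incidenceFinset_subset v)
      rw [← deg_eq_card_incidenceFinset, hr]
      omega
    obtain ⟨e, he, hv⟩ := hns v
    rw [← h1, SimpleGraph.mem_incidenceFinset] at he
    exact hv he.2
  have hsq : ∀ v, deg H v * deg H v = deg H v := by
    intro v
    have := hall v
    interval_cases h : deg H v <;> simp
  rw [sum_congr rfl (fun v _ => hsq v), sum_deg_eq, hr]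

/-- **THE STABILITY ON THE BIPARTITE CLASS AT `r = 2`:** two missing cross pairs that do not share a vertex cost
`2` below the closed form. -/
theorem closed_form_stability_bipSub_two (D : SimpleGraph V) [DecidableRel D.Adj] (A : Finset V) (hD : BipSub D A)
    (a : ℕ) (hA : A.card = a) (hm : D.edgeFinset.card + 2 = a * (Fintype.card V - a))
    (hr : 2 + 1 ≤ Fintype.card V) (hns : ¬ ∃ v, MissingStar D A v) :
    ∑ v, deg D v * deg D v + 2 * (Fintype.card V - 1 - 2) + 2 ≤ D.edgeFinset.card * Fintype.card V := by
  have key := sum_deg_sq_bipSub D A hD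
  have hM := card_edges_missingGraph D A hD a 2 hA hm
  rw [hM, hA] at key
  have hns' : ∀ v, ∃ e ∈ (missingGraph D A).edgeFinset, v ∉ e := by
    intro v
    by_contra hcon
    push Not at hcon
    apply hns
    refine ⟨v, fun x y hx hy hxy => ?_⟩
    have he : s(x, y) ∈ (missingGraph D A).edgeFinset := by
      rw [SimpleGraph.mem_edgeFinset, SimpleGraph.mem_edgeSet, missingGraph_adj]
      exact ⟨by tauto, hxy⟩
    have := hcon _ he
    rw [Sym2.mem_iff] at this
    rcases this with h | h
    · exact Or.inl h.symm
    · exact Or.inr h.symm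
  have hstab := sum_deg_sq_le_of_not_star_two (missingGraph D A) hM hns'
  rw [hM] at hstab
  obtain ⟨s, hs⟩ : ∃ s, Fintype.card V = 2 + 1 + s := ⟨_, (Nat.add_sub_cancel' hr).symm⟩
  have e : 2 + 1 + s - 1 - 2 = s := by omega
  rw [hs, e]
  rw [hs] at key hm
  generalize hS : ∑ v, deg D v * deg D v = S at key
  generalize hH : ∑ v, deg (missingGraph D A) v * deg (missingGraph D A) v = H at key hstab
  generalize hM' : D.edgeFinset.card = M at key hm
  generalize hP : a * (2 + 1 + s - a) = P at key hm
  nlinarith [key, hm, hstab]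

end C047

end TriangleCap

end PercRepro
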